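import Summits.QuantumFields.YangMills.Theorems.AllWindowsColdBoxBulkMidFluxExtensionGauge
import Summits.QuantumFields.YangMills.Theorems.AllWindowsColdBoxBulkMidFluxExtensionTransfinite
import Summits.QuantumFields.YangMills.Theorems.AllWindowsColdBoxBulkMidFluxExtensionNormal

/-!
# LINE-18 (crux `AllWindowsColdBox.BulkMidWindowSU2`, ⟨stmt-QuantumFields-24006⟩), toward the gauge-invariant flux maximum
# principle K3″: the L^∞ EXTENSION LEMMA for lattice 1-forms on the enlarged box

`exists_fluxExtension`: let `ϑ` be an edge function on `ℤ⁴` whose circulations over the SHELL plaquettes of the enlarged box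
`Λ⁺ = {−1,…,2H+1}⁴` (plaquettes of `Λ⁺` with a coordinate extremal at all four vertices) and over its CORNER plaquettes (base
point with two coordinates in `{−1, 2H}`, i.e. two normal links + two tangential shell edges at a boundary vertex of the cold
box `{0,…,2H}⁴`) are `≤ ε` in absolute value — these are exactly fully pinned plaquettes of the temporal-gauge Dirichlet
problem.  Then there is an edge function `A` with `A = ϑ` on EVERY edge of `Λ⁺` that is not an edge of the cold box (shell
edges and normal links) and `|sCirc A| ≤ 1219·ε` on EVERY plaquette of `Λ⁺`.
Proof = gauge with linear loss (`abs_sub_gaugePot_le`, `|ϑ − dΦ| ≤ 15(2H+2)ε` on tangential shell edges) → transfinite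
extension of `ϑ − dΦ` (`abs_sCirc_transfiniteA_le`: `3ε + 16·15(2H+2)ε/(2H+2) = 243ε`) → re-pinning of the normal links
(`repin_spec`: `5·243ε + 4ε`) → undo the gauge.

HONEST LABEL: helper toward an UNREGISTERED internal obligation (K3″) of a critic-passed DRAFT line on the R2ξ″ RECORD-rung crux
24006; no stub, crux, rung or summit is proved here; the Yang–Mills mass gap is NOT proved by this file.
-/

set_option autoImplicit false

noncomputable section

open Function
open Literature.Probability.LatticeModels (Site)
open Literature.MathematicalPhysics.QuantumFieldTheory
open Literature.MathematicalPhysics.QuantumFieldTheory.LatticeMaxwell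
open Literature.MathematicalPhysics.QuantumFieldTheory.AxialGauge
open Summit.QuantumFields.YangMills.Theorems.WeakCouplingRates

namespace Summit.QuantumFields.YangMills.Theorems.AllWindowsColdBoxBulkMidLine.FluxExt

variable {H : ℕ}

/-- Circulations are gauge invariant: `sCirc (ϑ − dΦ) = sCirc ϑ`. -/
theorem sCirc_sub_cobd (ϑ : Literature.MathematicalPhysics.QuantumLattice.ZdEdge 4 → ℝ) (Φ : Site 4 → ℝ) (p : Plaq 4) :
    sCirc (fun e => ϑ e - (Φ (e.1 + Pi.single e.2 1) - Φ e.1)) p = sCirc ϑ p := by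
  rw [sCirc_sub_fun, sCirc_coboundary_eq_zero, sub_zero]

/-- Circulations are gauge invariant: `sCirc (A + dΦ) = sCirc A`. -/
theorem sCirc_add_cobd (A : Literature.MathematicalPhysics.QuantumLattice.ZdEdge 4 → ℝ) (Φ : Site 4 → ℝ) (p : Plaq 4) :
    sCirc (fun e => A e + (Φ (e.1 + Pi.single e.2 1) - Φ e.1)) p = sCirc A p := by
  have h := sCirc_coboundary_eq_zero Φ p
  simp only [sCirc] at h ⊢
  linarith

/-- **The L^∞ extension lemma.**  If the circulations of `ϑ` over the shell plaquettes and the corner plaquettes of the enlarged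
box `{−1,…,2H+1}⁴` are `≤ ε` in absolute value (`H ≥ 1`), then some edge function `A` agrees with `ϑ` on every edge of the
enlarged box off the cold box `{0,…,2H}⁴` and has `|sCirc A| ≤ 1219·ε` on every plaquette of the enlarged box. -/
theorem exists_fluxExtension (hH : 1 ≤ H) {ϑ : Literature.MathematicalPhysics.QuantumLattice.ZdEdge 4 → ℝ} {ε : ℝ} (hε : 0 ≤ ε)
    (hshell : ∀ (z : Site 4) (a b c : Fin 4), a ≠ b → c ≠ a → c ≠ b → (∀ m, -1 ≤ z m ∧ z m ≤ 2 * (H : ℤ) + 1) →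
      z a ≤ 2 * (H : ℤ) → z b ≤ 2 * (H : ℤ) → (z c = -1 ∨ z c = 2 * (H : ℤ) + 1) → |sCirc ϑ (z, a, b)| ≤ ε)
    (hcorner : ∀ (y : Site 4) (i j : Fin 4), i ≠ j → (y i = -1 ∨ y i = 2 * (H : ℤ)) → (y j = -1 ∨ y j = 2 * (H : ℤ)) →
      (∀ m, -1 ≤ y m ∧ y m ≤ 2 * (H : ℤ) + 1) → |sCirc ϑ (y, i, j)| ≤ ε) :
    ∃ A : Literature.MathematicalPhysics.QuantumLattice.ZdEdge 4 → ℝ,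
      (∀ e ∈ boxEdgesAt dirCorner (2 * H + 3), e ∉ boxEdges 4 (2 * H + 1) → A e = ϑ e) ∧
      ∀ (y : Site 4) (i j : Fin 4), i ≠ j → (∀ m, -1 ≤ y m ∧ y m ≤ 2 * (H : ℤ) + 1) → y i ≤ 2 * (H : ℤ) →
        y j ≤ 2 * (H : ℤ) → |sCirc A (y, i, j)| ≤ 1219 * ε := by
  -- (G) the gauge
  set Φ : Site 4 → ℝ := gaugePot H ϑ with hΦ
  set ϑ' : Literature.MathematicalPhysics.QuantumLattice.ZdEdge 4 → ℝ := fun e => ϑ e - (Φ (e.1 + Pi.single e.2 1) - Φ e.1)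
    with hϑ'
  have hc' : ∀ p : Plaq 4, sCirc ϑ' p = sCirc ϑ p := fun p => sCirc_sub_cobd ϑ Φ p
  have hshell' : ∀ (z : Site 4) (a b c : Fin 4), a ≠ b → c ≠ a → c ≠ b → (∀ m, -1 ≤ z m ∧ z m ≤ 2 * (H : ℤ) + 1) →
      z a ≤ 2 * (H : ℤ) → z b ≤ 2 * (H : ℤ) → (z c = -1 ∨ z c = 2 * (H : ℤ) + 1) → |sCirc ϑ' (z, a, b)| ≤ ε := by
    intro z a b c hab hca hcb hz hza hzb hzc; rw [hc']; exact hshell z a b c hab hca hcb hz hza hzb hzc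
  have hcorner' : ∀ (y : Site 4) (i j : Fin 4), i ≠ j → (y i = -1 ∨ y i = 2 * (H : ℤ)) → (y j = -1 ∨ y j = 2 * (H : ℤ)) →
      (∀ m, -1 ≤ y m ∧ y m ≤ 2 * (H : ℤ) + 1) → |sCirc ϑ' (y, i, j)| ≤ ε := by
    intro y i j hij hyi hyj hy; rw [hc']; exact hcorner y i j hij hyi hyj hy
  have hval : ∀ (z : Site 4) (a c : Fin 4), c ≠ a → (∀ m, -1 ≤ z m ∧ z m ≤ 2 * (H : ℤ) + 1) → z a ≤ 2 * (H : ℤ) →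
      (z c = -1 ∨ z c = 2 * (H : ℤ) + 1) → |ϑ' (z, a)| ≤ 15 * (2 * H + 2) * ε := by
    intro z a c hca hz hza hzc
    exact abs_sub_gaugePot_le hε hshell hz hza ⟨c, hca, hzc⟩
  -- (T) the transfinite extension of the gauged datum
  have hT := fun (y : Site 4) (i j : Fin 4) (hij : i ≠ j) (hy : ∀ m, -1 ≤ y m ∧ y m ≤ 2 * (H : ℤ) + 1)
    (hyi : y i ≤ 2 * (H : ℤ)) (hyj : y j ≤ 2 * (H : ℤ)) =>
    abs_sCirc_transfiniteA_le (H := H) hshell' hval hij hy hyi hyj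
  have hM : (0 : ℝ) < 2 * H + 2 := by positivity
  have hC₁ : 3 * ε + 16 * (15 * (2 * H + 2) * ε) / (2 * H + 2) = 243 * ε := by field_simp; ring
  have hA_flux : ∀ (y : Site 4) (i j : Fin 4), i ≠ j → (∀ m, -1 ≤ y m ∧ y m ≤ 2 * (H : ℤ) + 1) →
      y i ≤ 2 * (H : ℤ) → y j ≤ 2 * (H : ℤ) → |sCirc (transfiniteA H ϑ') (y, i, j)| ≤ 243 * ε := by
    intro y i j hij hy hyi hyj; rw [← hC₁]; exact hT y i j hij hy hyi hyj
  have hA_tan : ∀ (y : Site 4) (i k : Fin 4), k ≠ i → (y k = -1 ∨ y k = 2 * (H : ℤ) + 1) →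
      transfiniteA H ϑ' (y, i) = ϑ' (y, i) := fun y i k hki hyk => transfiniteA_eq_of_extremal ϑ' hki hyk
  -- (N) re-pin the normal links
  obtain ⟨hpin, hflux⟩ := repin_spec (H := H) (A := transfiniteA H ϑ') (ϑ := ϑ') hH (by positivity) hε hA_tan hA_flux hcorner'
  -- (U) undo the gauge
  refine ⟨fun e => repin H (transfiniteA H ϑ') ϑ' e + (Φ (e.1 + Pi.single e.2 1) - Φ e.1), fun e hb hc => ?_,
    fun y i j hij hy hyi hyj => ?_⟩
  · change repin H (transfiniteA H ϑ') ϑ' e + (Φ (e.1 + Pi.single e.2 1) - Φ e.1) = ϑ e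
    rw [hpin e hb hc]
    simp only [hϑ']; ring
  · rw [sCirc_add_cobd]
    exact (hflux y i j hij hy hyi hyj).trans (by nlinarith)

end Summit.QuantumFields.YangMills.Theorems.AllWindowsColdBoxBulkMidLine.FluxExt

end
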